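import Mathlib
import Summits.Ventures.HodgeRepro.Tier4.Common.AdelicDefs
import Summits.Ventures.HodgeRepro.Tier4.Common.CompactOpenLevel
import Summits.Ventures.HodgeRepro.Tier4.Common.LevelBasis
import Summits.Ventures.HodgeRepro.Tier4.Line1.RTFSetting
import Summits.Ventures.HodgeRepro.Tier4.Line1.OrbitalTools
import Summits.Ventures.HodgeRepro.Tier4.Line1.RationalPoints
import Summits.Ventures.HodgeRepro.Tier4.Line1.RealisedSetting
import Summits.Ventures.HodgeRepro.Tier4.Line1.AdelicParts
import Summits.Ventures.HodgeRepro.Tier4.Line1.RationalConjFinite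
import Summits.Ventures.HodgeRepro.Tier4.Line1.FinLevelCompact
import Summits.Ventures.HodgeRepro.Tier4.Line1.FiniteLevelIsolation
import Summits.Ventures.HodgeRepro.Tier4.Line1.FiniteTypeAlgebra

/-!
# Tier4/Line4/IsolationArchCompactDC — C-L4-ISOLPROJ-DC: isolation on the DOUBLE COSET `(Ω·K(N)) γ₀ (Ω·K(N))` with a
compact archimedean support `Ω`

Blind re-derivation cell `pub-hodge-repro`, Tier 4 «PROVE THE STEP» (README §9–§10), LINE L4, seat t4-L2-p1 g2 on
t4-plan-4 g3's cut C-L4-ISOLPROJ-DC (S14225, census §11) — the double-coset twin of IsolationArchCompact p690544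
(`exists_level_isolating_of_archCompact`), i.e. t4-L1-p4's DoubleCosetIsolation p690357
(`exists_level_isolating_doubleCoset`, saturated by `K_N = K_f(N) × G_∞` on both sides under `hC : IsCompact (archImage W)`)
with the compact archimedean GROUP replaced by a compact archimedean SUPPORT `Ω ⊆ G_∞`.

WHY.  The consumer is the projector class `e ⋆ h ⋆ e` of the mixed seesaw plane (`U(1,1)` at the distinguished real
place, `G_∞` not compact): its support is `C · supp h · C` with `C = T′_∞ · K` bi-`K`-invariant, so the one-sided
`γ₀ • (Ω * K(N))` of ISOLPROJ cannot hold it; with `K := K(N)` and `h` supported in `Ω₀ • γ₀ • K(N)` the support lies in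
`(Ω * K(N)) * {γ₀} * (Ω * K(N))` for the compact, `N`-independent `Ω := T′_∞ · (Ω₀ ∪ {1})` — and then
`geoSupport (conv (projTest f) (projTest f′)) ⊆ {orbitOf γ₀}`, `Jc_eq_orbital_of_isolated`: the weak W5 in the projector
class is ONE three-torus orbital integral at deep level (residual purely local: FINPOS / WFIBRE / W0REL).

PROOF = DoubleCosetIsolation's with three substitutions: (1) the level-`1` compact set is `(Ω * K(1)) * {γ₀} * (Ω * K(1))`;
(2) the compact-open separation runs on the COMPACT set `(γ₀⁻¹ Ω γ₀) * Ω ⊆ G_∞` (`conj_mem_infinitePart`, `hΩ`) instead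
of on `G_∞`, then `K(N_γ)` inside `V₁ ∩ γ₀ V₁ γ₀⁻¹` with `V₁ V₁ ⊆ V` as before; (3) the factorisation
`γ₀⁻¹ · (a₁ b₁ γ₀ a₂ b₂) = ((γ₀⁻¹ a₁ γ₀) · a₂) · ((γ₀⁻¹ b₁ γ₀) · b₂)` — `a`'s in `Ω`, `b`'s in `K(N)` — uses that an element
with trivial FINITE part commutes with an element with trivial INFINITE part (`mul_comm_of_finM_eq_one_of_infM_eq_one`:
`M4_ext` + `finM_mul` / `infM_mul`), since `Ω` is not a group and the old normality argument is unavailable.  The rest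
(`orbitOf_eq_of_finPart_conj`, the finite bad-class set, `levelK_antitone`) verbatim.  0 print.  The declarations live in
the `Line1` namespace beside their twins.  Nothing here says anything about the status of the Hodge conjecture for CM
abelian varieties, which is NOT proved (HC_CM is NOT proved by anyone in this repository).
-/

set_option autoImplicit false

noncomputable section

namespace Summit.Ventures.HodgeRepro.Tier4.Line1

open Matrix NumberField IsDedekindDomain Topology Summit.Ventures.HodgeRepro.Tier4.Common
open scoped NumberField Pointwise

section Commute

variable {k : Type} [Field k] [NumberField k] (W : PlaneData k)

/-- An element with trivial finite part commutes with an element with trivial infinite part (`G_∞` and `G(𝔸_f)`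
commute): compare the two factorisations componentwise (`M4_ext`). -/
theorem mul_comm_of_finM_eq_one_of_infM_eq_one {a c : GA W} (ha : finM k (GA.mat W a) = 1)
    (hc : infM k (GA.mat W c) = 1) : a * c = c * a := by
  apply Subtype.ext
  apply Units.ext
  change GA.mat W (a * c) = GA.mat W (c * a)
  refine M4_ext (k := k) ?_ ?_
  · rw [GA.mat_mul, GA.mat_mul, infM_mul, infM_mul, hc, Matrix.mul_one, Matrix.one_mul]
  · rw [GA.mat_mul, GA.mat_mul, finM_mul, finM_mul, ha, Matrix.mul_one, Matrix.one_mul]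

/-- The infinite part of an element of `K(N)` is the identity matrix. -/
theorem infM_eq_one_of_mem_levelK {N : ℕ} {b : GA W} (hb : b ∈ levelK W N) : infM k (GA.mat W b) = 1 := by
  rw [← infM_one (k := k)]
  ext i j
  simp only [infM, Matrix.map_apply]
  have := infPart_entry_sub_one_eq_zero W (levelK_le_finitePart W N hb) i j
  rwa [Matrix.sub_apply, map_sub, sub_eq_zero] at this

/-- The infinite part of a conjugate of an element of `K(N)` by a rational point is the identity matrix. -/
theorem infM_conj_eq_one_of_mem_levelK {N : ℕ} {b : GA W} (hb : b ∈ levelK W N) (z : GA W) :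
    infM k (GA.mat W (z⁻¹ * b * z)) = 1 := by
  rw [GA.mat_mul, GA.mat_mul, infM_mul, infM_mul, infM_eq_one_of_mem_levelK W hb, Matrix.mul_one, ← infM_mul,
    GA.mat_inv_mul, infM_one]

end Commute

section Isolation

open MeasureTheory

variable {k : Type} [Field k] [NumberField k] (W : PlaneData k) [MeasurableSpace (GA W)] [BorelSpace (GA W)]
  (hW : IsDefinite W) (hg : IsGenuineRow W) (R : RTFData W) (μ : Measure (GA W)) [μ.IsHaarMeasure]
  [R.μT.IsHaarMeasure] [R.μT'.IsHaarMeasure] (hT : IsCompact (closure R.DT)) (hT' : IsCompact (closure R.DT'))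

/-- **C-L4-ISOLPROJ-DC — isolation on the double coset with a compact archimedean support**: for a compact `Ω ⊆ G_∞`
there is a level `N ≠ 0` such that every rational `γ` with `t⁻¹ γ t′ ∈ (Ω · K(N)) · {γ₀} · (Ω · K(N))` for some
`t ∈ closure DT`, `t′ ∈ closure DT′` lies in the rational double coset of `γ₀`. -/
theorem exists_level_isolating_doubleCoset_archCompact (Ω : Set (GA W))
    (hΩ : Ω ⊆ (infinitePart W : Set (GA W))) (hΩc : IsCompact Ω) (γ₀ : rationalPoints W)
    (hreg : IsLinRegular W γ₀) :
    ∃ N : ℕ, N ≠ 0 ∧ ∀ t ∈ closure (Setting.ofAdelic W hW hg R μ hT hT').DT,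
      ∀ t' ∈ closure (Setting.ofAdelic W hW hg R μ hT hT').DT', ∀ γ : (Setting.ofAdelic W hW hg R μ hT hT').Gk,
        (t : GA W)⁻¹ * γ * t' ∈
          (Ω * (levelK W N : Set (GA W))) * {(γ₀ : GA W)} * (Ω * (levelK W N : Set (GA W))) →
        (Setting.ofAdelic W hW hg R μ hT hT').orbitOf γ = (Setting.ofAdelic W hW hg R μ hT hT').orbitOf γ₀ := by
  classical
  haveI : T2Space (GA W) := t2Space_GA W
  have hK1 : IsCompact (levelK W 1 : Set (GA W)) := isCompact_levelK W one_ne_zero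
  -- the level-`1` double coset, compact
  have hM : IsCompact ((Ω * (levelK W 1 : Set (GA W))) * {(γ₀ : GA W)} * (Ω * (levelK W 1 : Set (GA W)))) :=
    ((hΩc.mul hK1).mul isCompact_singleton).mul (hΩc.mul hK1)
  -- the compact archimedean set `(γ₀⁻¹ Ω γ₀) · Ω ⊆ G_∞` on which the separation runs
  set Ω' : Set (GA W) := ((fun a : GA W => (γ₀ : GA W)⁻¹ * a * γ₀) '' Ω) * Ω with hΩ'def
  have hΩ'c : IsCompact Ω' :=
    (hΩc.image ((continuous_const.mul continuous_id).mul continuous_const)).mul hΩc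
  have hΩ'sub : Ω' ⊆ (infinitePart W : Set (GA W)) := by
    rintro x ⟨u, ⟨a, ha, rfl⟩, a₂, ha₂, rfl⟩
    exact (infinitePart W).mul_mem (conj_mem_infinitePart W (hΩ ha) _) (hΩ ha₂)
  -- for every rational point outside the double coset of `γ₀`, a level whose double coset misses it
  have hbad : ∀ γ : (Setting.ofAdelic W hW hg R μ hT hT').Gk,
      (Setting.ofAdelic W hW hg R μ hT hT').orbitOf γ ≠ (Setting.ofAdelic W hW hg R μ hT hT').orbitOf γ₀ →
      ∃ Nγ : ℕ, Nγ ≠ 0 ∧ ∀ t ∈ closure (Setting.ofAdelic W hW hg R μ hT hT').DT,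
        ∀ t' ∈ closure (Setting.ofAdelic W hW hg R μ hT hT').DT',
        (t : GA W)⁻¹ * γ * t' ∉
          (Ω * (levelK W Nγ : Set (GA W))) * {(γ₀ : GA W)} * (Ω * (levelK W Nγ : Set (GA W))) := by
    intro γ hne
    have hA : IsCompact ((fun t : (Setting.ofAdelic W hW hg R μ hT hT').T => (t : GA W)) ''
        closure (Setting.ofAdelic W hW hg R μ hT hT').DT) :=
      (Setting.ofAdelic W hW hg R μ hT hT').compT.image continuous_subtype_val
    have hB : IsCompact ((fun t : (Setting.ofAdelic W hW hg R μ hT hT').T' => (t : GA W)) ''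
        closure (Setting.ofAdelic W hW hg R μ hT hT').DT') :=
      (Setting.ofAdelic W hW hg R μ hT hT').compT'.image continuous_subtype_val
    -- the compact set `C = γ₀⁻¹ · {t⁻¹ γ t′}`
    set C : Set (GA W) := (fun p : GA W × GA W => (γ₀ : GA W)⁻¹ * (p.1⁻¹ * γ * p.2)) ''
      (((fun t : (Setting.ofAdelic W hW hg R μ hT hT').T => (t : GA W)) ''
          closure (Setting.ofAdelic W hW hg R μ hT hT').DT) ×ˢ
        ((fun t : (Setting.ofAdelic W hW hg R μ hT hT').T' => (t : GA W)) ''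
          closure (Setting.ofAdelic W hW hg R μ hT hT').DT')) with hCdef
    have hCc : IsCompact C :=
      (hA.prod hB).image (continuous_const.mul ((continuous_fst.inv.mul continuous_const).mul continuous_snd))
    -- `C` misses `G_∞`: the finite-adelic core
    have hdisj : ∀ t ∈ closure (Setting.ofAdelic W hW hg R μ hT hT').DT,
        ∀ t' ∈ closure (Setting.ofAdelic W hW hg R μ hT hT').DT',
        (γ₀ : GA W)⁻¹ * ((t : GA W)⁻¹ * γ * t') ∉ infinitePart W := by
      intro t _ t' _ hmem
      apply hne
      have h1 : finM k (GA.mat W ((t : GA W)⁻¹ * γ * t')) = finM k (GA.mat W (γ₀ : GA W)) := by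
        have hm := (mem_infinitePart W _).1 hmem
        rw [GA.mat_mul, finM_mul] at hm
        calc finM k (GA.mat W ((t : GA W)⁻¹ * γ * t'))
            = (finM k (GA.mat W (γ₀ : GA W)) * finM k (GA.mat W (γ₀ : GA W)⁻¹)) *
                finM k (GA.mat W ((t : GA W)⁻¹ * γ * t')) := by
              rw [← finM_mul, GA.mat_mul_inv, finM_one, Matrix.one_mul]
          _ = finM k (GA.mat W (γ₀ : GA W)) *
                (finM k (GA.mat W (γ₀ : GA W)⁻¹) * finM k (GA.mat W ((t : GA W)⁻¹ * γ * t'))) :=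
              Matrix.mul_assoc _ _ _
          _ = finM k (GA.mat W (γ₀ : GA W)) := by rw [hm, Matrix.mul_one]
      exact orbitOf_eq_of_finPart_conj W hW hg R μ hT hT' γ γ₀ hreg t.2 t'.2
        (fun i j => congrFun (congrFun h1 i) j)
    have hU : IsOpen Cᶜ := hCc.isClosed.isOpen_compl
    have hsub : Ω' ⊆ Cᶜ := by
      rintro a ha ⟨⟨_, _⟩, ⟨⟨τ, hτ, rfl⟩, ⟨τ', hτ', rfl⟩⟩, hfa⟩
      have ha' : a ∈ infinitePart W := hΩ'sub ha
      rw [← hfa] at ha'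
      exact hdisj τ hτ τ' hτ' ha'
    obtain ⟨V, hV, hVsub⟩ := compact_open_separated_mul_right hΩ'c hU hsub
    -- `V₁ V₁ ⊆ V`, and `K(N)` inside `V₁ ∩ γ₀ V₁ γ₀⁻¹`
    obtain ⟨V₁, hV₁o, hV₁1, hV₁V⟩ := exists_open_nhds_one_mul_subset hV
    have hV₁n : V₁ ∈ 𝓝 (1 : GA W) := hV₁o.mem_nhds hV₁1
    have hV₂n : (fun x : GA W => (γ₀ : GA W)⁻¹ * x * γ₀) ⁻¹' V₁ ∈ 𝓝 (1 : GA W) := by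
      have hc : Continuous fun x : GA W => (γ₀ : GA W)⁻¹ * x * γ₀ :=
        (continuous_const.mul continuous_id).mul continuous_const
      have h1 : (γ₀ : GA W)⁻¹ * 1 * γ₀ = 1 := by simp
      exact hc.continuousAt.preimage_mem_nhds (by simp only [h1]; exact hV₁n)
    obtain ⟨Nγ, hNγ, hKV⟩ := exists_levelK_subset_nhds_one W (Filter.inter_mem hV₁n hV₂n)
    refine ⟨Nγ, hNγ, fun t ht t' ht' hmem => ?_⟩
    -- unpack the double coset membership
    obtain ⟨y, hy, k₂, hk₂, hyk⟩ := Set.mem_mul.1 hmem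
    obtain ⟨k₁, hk₁, g₀, hg₀, hkg⟩ := Set.mem_mul.1 hy
    rw [Set.mem_singleton_iff] at hg₀
    subst hg₀
    obtain ⟨a₁, ha₁, b₁, hb₁, rfl⟩ := Set.mem_mul.1 hk₁
    obtain ⟨a₂, ha₂, b₂, hb₂, rfl⟩ := Set.mem_mul.1 hk₂
    rw [SetLike.mem_coe] at hb₁ hb₂
    have hin : (γ₀ : GA W)⁻¹ * ((t : GA W)⁻¹ * γ * t') ∈ C :=
      ⟨((t : GA W), (t' : GA W)), ⟨⟨t, ht, rfl⟩, ⟨t', ht', rfl⟩⟩, rfl⟩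
    apply hVsub _ hin
    rw [← hyk, ← hkg]
    -- the conjugate of `b₁` has trivial infinite part and so commutes with `a₂ ∈ Ω ⊆ G_∞`
    have hcomm : ((γ₀ : GA W)⁻¹ * b₁ * γ₀) * a₂ = a₂ * ((γ₀ : GA W)⁻¹ * b₁ * γ₀) :=
      (mul_comm_of_finM_eq_one_of_infM_eq_one W ((mem_infinitePart W _).1 (hΩ ha₂))
        (infM_conj_eq_one_of_mem_levelK W hb₁ _)).symm
    have hfac : (γ₀ : GA W)⁻¹ * (a₁ * b₁ * γ₀ * (a₂ * b₂)) =
        (((γ₀ : GA W)⁻¹ * a₁ * γ₀) * a₂) * (((γ₀ : GA W)⁻¹ * b₁ * γ₀) * b₂) := by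
      calc (γ₀ : GA W)⁻¹ * (a₁ * b₁ * γ₀ * (a₂ * b₂))
          = ((γ₀ : GA W)⁻¹ * a₁ * γ₀) * (((γ₀ : GA W)⁻¹ * b₁ * γ₀) * a₂) * b₂ := by group
        _ = ((γ₀ : GA W)⁻¹ * a₁ * γ₀) * (a₂ * ((γ₀ : GA W)⁻¹ * b₁ * γ₀)) * b₂ := by rw [hcomm]
        _ = (((γ₀ : GA W)⁻¹ * a₁ * γ₀) * a₂) * (((γ₀ : GA W)⁻¹ * b₁ * γ₀) * b₂) := by group
    rw [hfac]
    exact Set.mul_mem_mul (Set.mul_mem_mul (Set.mem_image_of_mem _ ha₁) ha₂)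
      (hV₁V (Set.mul_mem_mul (hKV hb₁).2 (hKV hb₂).1))
  choose! Nf hNf using hbad
  -- the finite set of rational points hit by the level-`1` double coset, and the product level over its bad members
  set Γ : Finset (Setting.ofAdelic W hW hg R μ hT hT').Gk :=
    ((Setting.ofAdelic W hW hg R μ hT hT').finite_hit_closure hM).toFinset with hΓ
  set N : ℕ := ∏ γ ∈ Γ.filter (fun γ =>
    (Setting.ofAdelic W hW hg R μ hT hT').orbitOf γ ≠ (Setting.ofAdelic W hW hg R μ hT hT').orbitOf γ₀), Nf γ
    with hN
  have hmono : ∀ {M N' : ℕ}, M ∣ N' →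
      (Ω * (levelK W N' : Set (GA W))) * {(γ₀ : GA W)} * (Ω * (levelK W N' : Set (GA W))) ⊆
      (Ω * (levelK W M : Set (GA W))) * {(γ₀ : GA W)} * (Ω * (levelK W M : Set (GA W))) := fun hdvd =>
    Set.mul_subset_mul
      (Set.mul_subset_mul_right (Set.mul_subset_mul_left (SetLike.coe_subset_coe.2 (levelK_antitone W hdvd))))
      (Set.mul_subset_mul_left (SetLike.coe_subset_coe.2 (levelK_antitone W hdvd)))
  refine ⟨N, ?_, ?_⟩
  · rw [hN, Finset.prod_ne_zero_iff]
    intro γ hγ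
    exact (hNf γ (Finset.mem_filter.1 hγ).2).1
  · intro t ht t' ht' γ hmem
    by_contra hne
    have hγΓ : γ ∈ Γ := by
      rw [hΓ, Set.Finite.mem_toFinset]
      exact ⟨t, ht, t', ht', hmono (one_dvd N) hmem⟩
    have hdvd : Nf γ ∣ N := Finset.dvd_prod_of_mem _ (Finset.mem_filter.2 ⟨hγΓ, hne⟩)
    exact (hNf γ hne).2 t ht t' ht' (hmono hdvd hmem)

end Isolation

end Summit.Ventures.HodgeRepro.Tier4.Line1

end
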